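import Mathlib
import HarnessLib
import Literature.Combinatorics.Additive.KempermanElementaryPairs
import Literature.Combinatorics.Additive.KempermanStructureTheorem

/-!
# Kemperman 1960, Theorem 2.1: the sum of a critical pair is an arithmetic progression or
# quasi-periodic

[cite: Kemperman1960, Thm 2.1] [tag: critical-pair] [tag: inverse-theorem]

Topic `Literature/Combinatorics/Additive`.  Cell `mm-stpp` (D-0046), seat `mm-stpp-lit` (gen 22); the
first brick of the «only if» half of the Kemperman Structure Theorem in the quasi-periodic language
(`KempermanElementaryPairs.lean`: the vocabulary, the «if» half, Kemperman §4 Lemmas 4.1–4.3), built on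
the tree's Boothby–DeVos–Montejano classification of critical trios (`CriticalTrios.lean`,
`KempermanStructures.lean`, `KempermanStructureTheorem.lean`: `kemperman_structure_step`, pure and
impure beats and chords, continuations, `toSub`).

SOURCE.  J. H. B. Kemperman, *On small sumsets in an abelian group*, Acta Math. **103** (1960) 63–88,
§2, THEOREM 2.1 (p. 65 of the held text `paper:doi-10-1007-bf02546525`, p0003 L16): «Let `A`, `B` be
finite subsets of `G` such that (1) [`|A + B| ≤ |A| + |B| − 1`] holds and `|A| ≥ 2`, `|B| ≥ 2`.  Then
either `A + B` is in arithmetic progression or `A + B` is quasi-periodic.»  (Kemperman's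
«quasi-periodic», p. 64: «the disjoint union of a non-empty set `C'` consisting of `F`-cosets … and a
residual set `C''` contained in a remaining `F`-coset», `|F| ≥ 2` = the tree's `IsQuasiPeriodic`;
«in arithmetic progression» = the tree's `IsAP`.)

MAIN RESULT.  `isAP_or_isQuasiPeriodic_add_of_card_add_le` — Theorem 2.1 for FINITE abelian groups
(`-- TODO(general form)`: Kemperman allows arbitrary abelian `G`; the Boothby–DeVos–Montejano files
are finite-group only).  0 named facts; everything PROVED.

PROOF (ours — Kemperman's goes through his Lemma 2.2, a refinement of Kneser's proof).  If `A + B` is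
periodic it is quasi-periodic.  Otherwise Kneser gives `|A + B| = |A| + |B| − 1`, and
`(A, B, \overline{−(A+B)})` is a maximal trio of deficiency `1` (`purePair_critical_iff_maximalTrio`).
We prove, by induction on `|G|` over all finite abelian groups, that every maximal trio `(A, B, C)` of
deficiency `1` with nonempty members has the PAIR PROPERTY: for each two of its members of size `≥ 2`,
their sum is a progression or quasi-periodic (a property invariant under the similarities of
Boothby–DeVos–Montejano — permutations and translations `(A + g, B − g, C)` — `Similar.trioSumAPQP`).
By `kemperman_structure_step` the trio is a pure beat, pure chord, impure beat or impure chord relative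
to a proper subgroup `H`:
* pure beat / pure chord: their deficiency is `|H|` (`IsPureBeat.isMaximalTrio`,
  `IsPureChord.isMaximalTrio`), so `H = {0}`; a pure beat in normal position is `({0}, B, C)` with
  `B + C = −({0}ᶜ) = G ∖ {0}`, a progression or quasi-periodic (`isAP_or_isQuasiPeriodic_univ_erase`:
  quasi-periodic if `G` has a nontrivial proper subgroup, else a progression of any nonzero
  difference); a pure chord in normal position has `A`, `B` progressions of a difference `r` with
  `⟨r⟩ = G`, so `A + B`, `B + C = −(Aᶜ)`, `C + A = −(Bᶜ)` are progressions (complements and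
  negatives of progressions in a cyclic group, `IsAP.compl_of_zmultiples_eq_top`);
* impure chord rel. `H` (then `|H| ≥ 2`, `two_le_card_carrier`): `(A + B) ∖ H`
  (`IsImpureChordAt.add_sdiff_eq`), `(B + C) ∖ H = −((H ∪ A)ᶜ)` and `(C + A) ∖ H = −((H ∪ B)ᶜ)` are
  nonempty and `H`-periodic, so the three sums are quasi-periodic
  (`isQuasiPeriodic_of_isPeriodicWith_sdiff`);
* impure beat rel. `H`: `(B + C) ∖ H = −(Hᶜ) ≠ ∅` is `H`-periodic; `(A + B) ∖ H = B ∖ H`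
  (`IsImpureBeatAt.add_sdiff_eq`) is `H`-periodic, and if it is empty then `B ⊆ H` and `A + B` is a
  pair sum of the continuation `(A, B ∩ H, C ∩ H)`, a maximal trio of deficiency `1` in the smaller
  group `H` — induction, transported along `toSub` (`trioSumAPQP_of_toSub`: progressions and
  quasi-periodic sets of `↥H` are such in `G`); likewise `(C + A) ∖ H = −((B ∪ H)ᶜ)`, and if it is
  empty then `C ⊆ H` and `C + A` is a pair sum of the continuation.
Here `X + Y = −(Zᶜ)` for a maximal trio `(Z, X, Y)` (`IsMaximalTrio.add_eq_neg_compl`, from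
`isMaximalTrio_iff`).

Also: `isQuasiPeriodic_of_isPeriodicWith_sdiff` (a set whose part outside a nontrivial subgroup is
nonempty and periodic is quasi-periodic), `IsPeriodicWith.sdiff`, `isPeriodicWith_carrier`,
`isAP_or_isQuasiPeriodic_univ_erase`.

## References
* J. H. B. Kemperman, *On small sumsets in an abelian group*, Acta Math. 103 (1960) 63–88,
  doi:10.1007/BF02546525, §2 Theorem 2.1 (p. 65; definitions of quasi-periodic sets and progressions
  p. 64) — held `paper:doi-10-1007-bf02546525`, p0002–p0003 read 2026-08-29 [cite: Kemperman1960, Thm 2.1].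
* T. Boothby, M. DeVos, A. Montejano, *A new proof of Kemperman's theorem*, Integers 15 (2015) #A5,
  arXiv:1301.0095, §4 (Definitions 4.1–4.4, Theorem 4.5) — the classification walked here, as
  formalized in `KempermanStructures.lean` / `KempermanStructureTheorem.lean`
  [cite: BoothbyDevosMontejano2013, Thm 4.5].
* D. J. Grynkiewicz, *A step beyond Kemperman's structure theorem*, Mathematika 55 (2009) 67–114, §2
  (quasi-periodic decompositions; the vocabulary files) [cite: Grynkiewicz2009, §2].
-/

namespace Literature.Combinatorics.Additive

open Finset
open scoped Pointwise

universe u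

section General

variable {G : Type*} [AddCommGroup G] [DecidableEq G]

/-! ### The property «progression or quasi-periodic» and its invariances -/

/-- «`X` is in arithmetic progression or quasi-periodic» (the conclusion of Kemperman's Theorem 2.1).
[cite: Kemperman1960, Thm 2.1] -/
private def SumAPQP (X : Finset G) : Prop := (∃ d, IsAP X d) ∨ IsQuasiPeriodic X

/-- Translation invariance of «progression or quasi-periodic». [cite: Kemperman1960, Thm 2.1] -/
private theorem sumAPQP_vadd_iff {X : Finset G} (g : G) : SumAPQP (g +ᵥ X) ↔ SumAPQP X := by
  unfold SumAPQP
  rw [isQuasiPeriodic_vadd_iff]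
  constructor
  · rintro (⟨d, hd⟩ | h)
    · exact Or.inl ⟨d, (isAP_vadd_iff g).1 hd⟩
    · exact Or.inr h
  · rintro (⟨d, hd⟩ | h)
    · exact Or.inl ⟨d, hd.vadd g⟩
    · exact Or.inr h

/-- For the three pairs of a triple: each sum of two members of size `≥ 2` is a progression or
quasi-periodic. [cite: Kemperman1960, Thm 2.1] -/
private def TrioSumAPQP (A B C : Finset G) : Prop :=
  (2 ≤ #A → 2 ≤ #B → SumAPQP (A + B)) ∧ (2 ≤ #B → 2 ≤ #C → SumAPQP (B + C)) ∧
    (2 ≤ #C → 2 ≤ #A → SumAPQP (C + A))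

/-- The pair property is invariant under rotating the triple. [cite: Kemperman1960, Thm 2.1] -/
private theorem trioSumAPQP_rotate {A B C : Finset G} (h : TrioSumAPQP A B C) : TrioSumAPQP B C A :=
  ⟨h.2.1, h.2.2, h.1⟩

/-- The pair property is invariant under swapping two members. [cite: Kemperman1960, Thm 2.1] -/
private theorem trioSumAPQP_swap {A B C : Finset G} (h : TrioSumAPQP A B C) : TrioSumAPQP B A C := by
  obtain ⟨h1, h2, h3⟩ := h
  refine ⟨fun hB hA => ?_, fun hA hC => ?_, fun hC hB => ?_⟩
  · rw [add_comm]; exact h1 hA hB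
  · rw [add_comm]; exact h3 hC hA
  · rw [add_comm]; exact h2 hB hC

/-- The pair property is invariant under the translations `(A + g, B − g, C)`.
[cite: Kemperman1960, Thm 2.1] [cite: BoothbyDevosMontejano2013, §4] -/
private theorem trioSumAPQP_translate {A B C : Finset G} (g : G) (h : TrioSumAPQP A B C) :
    TrioSumAPQP (g +ᵥ A) (-g +ᵥ B) C := by
  obtain ⟨h1, h2, h3⟩ := h
  refine ⟨fun hA hB => ?_, fun hB hC => ?_, fun hC hA => ?_⟩
  · rw [card_vadd_finset] at hA hB
    rw [vadd_add_neg_vadd]; exact h1 hA hB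
  · rw [card_vadd_finset] at hB
    rw [vadd_add_assoc, sumAPQP_vadd_iff]; exact h2 hB hC
  · rw [card_vadd_finset] at hA
    rw [add_comm C, vadd_add_assoc, sumAPQP_vadd_iff, add_comm A C]; exact h3 hC hA

/-- The pair property transports along similarity. [cite: BoothbyDevosMontejano2013, §4] -/
private theorem Similar.trioSumAPQP {T U : Finset G × Finset G × Finset G} (h : Similar T U)
    (hT : TrioSumAPQP T.1 T.2.1 T.2.2) : TrioSumAPQP U.1 U.2.1 U.2.2 := by
  induction h with
  | refl => exact hT
  | rotate _ ih => exact trioSumAPQP_rotate ih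
  | swap _ ih => exact trioSumAPQP_swap ih
  | translate g _ ih => exact trioSumAPQP_translate g ih

/-! ### Quasi-periodicity from a periodic part outside a subgroup -/

/-- If the part of `X` outside a nontrivial subgroup `H` is nonempty and `H`-periodic, then `X` is
quasi-periodic (with quasi-period `H`: `X = (X ∖ H) ∪ (X ∩ H)`). [cite: Kemperman1960, §2 (definition of
quasi-periodic sets)] -/
theorem isQuasiPeriodic_of_isPeriodicWith_sdiff {H : AddSubgroup G} {Hf X : Finset G}
    (hHf : ∀ g, g ∈ Hf ↔ g ∈ H) (hH : H ≠ ⊥) (hper : IsPeriodicWith H (X \ Hf))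
    (hne : (X \ Hf).Nonempty) : IsQuasiPeriodic X :=
  ⟨H, X \ Hf, X ∩ Hf, ⟨hH, disjoint_sdiff_inter X Hf, sdiff_union_inter X Hf, hper,
    fun x hx y hy => H.sub_mem ((hHf x).1 (mem_inter.1 hx).2) ((hHf y).1 (mem_inter.1 hy).2)⟩, hne⟩

/-- A difference of `H`-periodic sets is `H`-periodic. [cite: Grynkiewicz2009, §2] -/
theorem IsPeriodicWith.sdiff {H : AddSubgroup G} {X Y : Finset G} (hX : IsPeriodicWith H X)
    (hY : IsPeriodicWith H Y) : IsPeriodicWith H (X \ Y) := fun h hh => by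
  rw [vadd_finset_sdiff, hX h hh, hY h hh]

/-- The finset carrying `H` is `H`-periodic. [cite: Grynkiewicz2009, §2] -/
theorem isPeriodicWith_carrier {H : AddSubgroup G} {Hf : Finset G} (hHf : ∀ g, g ∈ Hf ↔ g ∈ H) :
    IsPeriodicWith H Hf := fun _ hh => vadd_finset_eq_of_forall_mem_iff hHf hh

/-- `(−Xᶜ) ∖ H = −((X ∪ H)ᶜ)` for a subgroup carrier `H` (so `−H = H`). [cite: Kemperman1960, §4] -/
theorem neg_compl_sdiff_eq [Fintype G] {H : Finset G} (hH : IsSubgroupCarrier H)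
    (X : Finset G) : (-Xᶜ) \ H = -(X ∪ H)ᶜ := by
  ext x
  simp only [mem_sdiff, mem_neg', mem_compl, mem_union, not_or]
  constructor
  · rintro ⟨h1, h2⟩
    refine ⟨h1, fun h3 => h2 ?_⟩
    have := hH.neg_mem h3
    rwa [neg_neg] at this
  · rintro ⟨h1, h2⟩
    exact ⟨h1, fun h3 => h2 (hH.neg_mem h3)⟩

/-- For a maximal trio, `B + C = −(Aᶜ)` (from `A = third B C`). [cite: BoothbyDevosMontejano2013, §3] -/
theorem IsMaximalTrio.add_eq_neg_compl [Fintype G] {A B C : Finset G}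
    (h : IsMaximalTrio A B C) : B + C = -Aᶜ := by
  have := (isMaximalTrio_iff.1 h).2.2
  rw [this, third, compl_compl, neg_neg]

/-! ### `G ∖ {g}` is a progression or quasi-periodic -/

/-- In a finite abelian group with at least two elements, the complement of a point is a progression
(when some nonzero element generates `G`, e.g. `G` cyclic of prime order) or quasi-periodic (when
`G` has a nontrivial proper subgroup). [cite: Kemperman1960, §2 (Thm 2.1); §5 (proof of Lemma 5.2,
case (ii))] -/
theorem isAP_or_isQuasiPeriodic_univ_erase [Fintype G] (h2 : 2 ≤ Fintype.card G) (g : G) :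
    (∃ d, IsAP (univ.erase g) d) ∨ IsQuasiPeriodic (univ.erase g) := by
  classical
  by_cases hK : ∃ K : AddSubgroup G, K ≠ ⊥ ∧ K ≠ ⊤
  · obtain ⟨K, hKb, hKt⟩ := hK
    right
    set Kf : Finset G := univ.filter fun x => x ∈ K with hKf
    have hHf : ∀ x, x ∈ Kf ↔ x ∈ K := fun x => by rw [hKf, mem_filter]; simp
    have hg : g ∈ g +ᵥ Kf := mem_vadd_finset.2 ⟨0, (hHf 0).2 K.zero_mem, by rw [vadd_eq_add, add_zero]⟩
    refine ⟨K, univ.erase g \ (g +ᵥ Kf), univ.erase g ∩ (g +ᵥ Kf),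
      ⟨hKb, disjoint_sdiff_inter _ _, sdiff_union_inter _ _, ?_, ?_⟩, ?_⟩
    · have : univ.erase g \ (g +ᵥ Kf) = (g +ᵥ Kf)ᶜ := by
        ext x
        simp only [mem_sdiff, mem_erase, mem_univ, mem_compl, and_true]
        constructor
        · exact fun h => h.2
        · intro h
          exact ⟨fun hx => h (hx ▸ hg), h⟩
      rw [this]
      exact (isPeriodicWith_vadd_carrier hHf g).compl
    · intro x hx y hy
      obtain ⟨a, ha, rfl⟩ := mem_vadd_finset.1 (mem_inter.1 hx).2
      obtain ⟨b, hb, rfl⟩ := mem_vadd_finset.1 (mem_inter.1 hy).2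
      have e : (g +ᵥ a) - (g +ᵥ b) = a - b := by simp only [vadd_eq_add]; abel
      rw [e]
      exact K.sub_mem ((hHf a).1 ha) ((hHf b).1 hb)
    · obtain ⟨z, hz⟩ : ∃ z : G, z ∉ K := by
        by_contra hne
        push Not at hne
        exact hKt (eq_top_iff.2 fun x _ => hne x)
      refine ⟨g + z, mem_sdiff.2 ⟨mem_erase.2 ⟨fun h => hz ?_, mem_univ _⟩, fun h => hz ?_⟩⟩
      · have : z = 0 := by
          have := congrArg (· - g) h
          simpa using this
        rw [this]; exact K.zero_mem
      · obtain ⟨w, hw, hgw⟩ := mem_vadd_finset.1 h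
        rw [vadd_eq_add, add_right_inj] at hgw
        rw [← hgw]; exact (hHf w).1 hw
  · push Not at hK
    left
    obtain ⟨d, hd0⟩ : ∃ d : G, d ≠ 0 := by
      obtain ⟨x, y, hxy⟩ := Fintype.one_lt_card_iff.1 (by omega : 1 < Fintype.card G)
      by_cases hx : x = 0
      · exact ⟨y, fun hy => hxy (by rw [hx, hy])⟩
      · exact ⟨x, hx⟩
    have htop : AddSubgroup.zmultiples d = ⊤ := by
      have := hK (AddSubgroup.zmultiples d)
      by_contra hne
      exact absurd (this (by rwa [Ne, AddSubgroup.zmultiples_eq_bot])) hne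
    have hn : addOrderOf d = Fintype.card G := Isoperimetric.addOrderOf_eq_card_of_zmultiples_eq_top htop
    have huniv : apFinset g d (addOrderOf d) = univ := by
      rw [← add_zero g, ← vadd_apFinset, Isoperimetric.apFinset_zero_addOrderOf_eq_univ htop,
        vadd_finset_univ]
    obtain ⟨k, hk⟩ : ∃ k, addOrderOf d = 1 + k := ⟨addOrderOf d - 1, by omega⟩
    have hsplit : univ = {g} ∪ apFinset (g + d) d k := by
      rw [← huniv, hk, apFinset_add_eq_union, apFinset_one, one_nsmul]
    have hck : #(apFinset (g + d) d k) = k :=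
      Isoperimetric.card_apFinset_of_le_addOrderOf _ _ (by omega)
    have hg : g ∉ apFinset (g + d) d k := by
      intro hg
      have h1 : ({g} : Finset G) ∪ apFinset (g + d) d k = apFinset (g + d) d k :=
        union_eq_right.2 (singleton_subset_iff.2 hg)
      have h2 := congrArg Finset.card hsplit
      rw [h1, card_univ, hck] at h2
      omega
    have herase : univ.erase g = apFinset (g + d) d k := by
      rw [hsplit, ← insert_eq, erase_insert hg]
    refine ⟨d, g + d, ?_⟩
    rw [herase, hck]

end General

section Structures

variable {G : Type*} [AddCommGroup G] [Fintype G] [DecidableEq G]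

/-! ### Subgroup carriers: trivial and nontrivial -/

omit [Fintype G] [DecidableEq G] in
/-- A subgroup carrier with one element is `{0}`. [cite: BoothbyDevosMontejano2013, §4] -/
theorem carrier_eq_singleton_zero {H : Finset G} (hH : IsSubgroupCarrier H) (h1 : #H = 1) :
    H = {0} := by
  obtain ⟨a, ha⟩ := card_eq_one.1 h1
  have : (0 : G) ∈ H := hH.zero_mem
  rw [ha, mem_singleton] at this
  rw [ha, ← this]

omit [Fintype G] in
/-- The members of a trio cannot all contain `0`; so an impure structure needs `|H| ≥ 2`.
[cite: BoothbyDevosMontejano2013, §4] -/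
theorem two_le_card_carrier {H A B C : Finset G} (hH : IsSubgroupCarrier H) (ht : IsTrio A B C)
    (hA : (A ∩ H).Nonempty) (hB : (B ∩ H).Nonempty) (hC : (C ∩ H).Nonempty) : 2 ≤ #H := by
  by_contra hlt
  have h1 : #H = 1 := by
    have := hH.nonempty.card_pos
    omega
  have hH0 := carrier_eq_singleton_zero hH h1
  have mem0 : ∀ {X : Finset G}, (X ∩ H).Nonempty → (0 : G) ∈ X := by
    intro X hX
    obtain ⟨x, hx⟩ := hX
    rw [hH0, mem_inter, mem_singleton] at hx
    rw [← hx.2]; exact hx.1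
  refine ht (by
    have : (0 : G) + 0 + 0 ∈ A + B + C := add_mem_add (add_mem_add (mem0 hA) (mem0 hB)) (mem0 hC)
    simpa using this)

/-! ### Pure structures at deficiency one: `H` is trivial -/

omit [Fintype G] in
/-- An `R`-sequence relative to the trivial subgroup is an arithmetic progression.
[cite: BoothbyDevosMontejano2013, §4 (R-sequences)] -/
theorem rseq_singleton_zero (r a : G) (m : ℕ) :
    rseq ({0} : Finset G) r a m = apFinset a r m := by
  ext x
  rw [mem_rseq, mem_apFinset]
  constructor
  · rintro ⟨i, hi, hx⟩
    obtain ⟨z, hz, rfl⟩ := mem_vadd_finset.1 hx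
    rw [mem_singleton] at hz
    exact ⟨i, hi, by rw [hz, vadd_eq_add, add_zero]⟩
  · rintro ⟨i, hi, rfl⟩
    exact ⟨i, hi, mem_vadd_finset.2 ⟨0, mem_singleton_self 0, by rw [vadd_eq_add, add_zero]⟩⟩

omit [Fintype G] in
/-- `G/{0}` cyclic generated by `r` means `⟨r⟩ = G`. [cite: BoothbyDevosMontejano2013, §4] -/
theorem zmultiples_eq_top_of_isCyclicQuotGen {r : G} (h : IsCyclicQuotGen ({0} : Finset G) r) :
    AddSubgroup.zmultiples r = ⊤ := by
  rw [eq_top_iff]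
  intro x _
  obtain ⟨i, hi⟩ := h x
  obtain ⟨z, hz, rfl⟩ := mem_vadd_finset.1 hi
  rw [mem_singleton] at hz
  rw [hz, vadd_eq_add, add_zero]
  exact AddSubgroup.nsmul_mem _ (AddSubgroup.mem_zmultiples r) i

/-- A pure beat relative to the trivial subgroup: `A = {0}`, and `B + C = G ∖ {0}` is a progression
or quasi-periodic. [cite: Kemperman1960, Thm 2.1] [cite: BoothbyDevosMontejano2013, Def 4.1] -/
private theorem trioSumAPQP_of_isPureBeatAt {A B C : Finset G}
    (h : IsPureBeatAt ({0} : Finset G) A B C) : TrioSumAPQP A B C := by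
  have hH : IsSubgroupCarrier ({0} : Finset G) := by
    refine IsSubgroupCarrier.of_coe_eq (⊥ : AddSubgroup G) ?_
    rw [coe_singleton, AddSubgroup.coe_bot]
  have hmax := (h.isMaximalTrio hH).1
  obtain ⟨hA, -, -, hCne⟩ := h
  have hA1 : #A = 1 := by rw [hA, card_singleton]
  refine ⟨fun h2 _ => by omega, fun h2B h2C => ?_, fun _ h2 => by omega⟩
  have hBC : B + C = univ.erase 0 := by
    rw [hmax.add_eq_neg_compl, hA]
    ext x
    simp [mem_neg', mem_compl]
  have h2G : 2 ≤ Fintype.card G := by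
    have := card_le_univ B
    omega
  unfold SumAPQP
  rw [hBC]
  exact isAP_or_isQuasiPeriodic_univ_erase h2G 0

/-- A pure chord relative to the trivial subgroup: `A`, `B` are progressions of difference `r`,
`⟨r⟩ = G`, and all three pair sums are progressions. [cite: Kemperman1960, Thm 2.1]
[cite: BoothbyDevosMontejano2013, Def 4.2] -/
private theorem trioSumAPQP_of_isPureChordAt {A B C : Finset G} {r : G}
    (h : IsPureChordAt ({0} : Finset G) r A B C) : TrioSumAPQP A B C := by
  have hH : IsSubgroupCarrier ({0} : Finset G) := by
    refine IsSubgroupCarrier.of_coe_eq (⊥ : AddSubgroup G) ?_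
    rw [coe_singleton, AddSubgroup.coe_bot]
  have hmax := (h.isMaximalTrio hH).1
  have htop := zmultiples_eq_top_of_isCyclicQuotGen h.1
  obtain ⟨a, b, m, n, hm, hn, hA, hB, hsum, -, hcA, hcB, hcAB⟩ := h.card_eq hH
  rw [card_singleton, mul_one] at hcA hcB hcAB
  rw [rseq_singleton_zero] at hA hB hsum
  have hAP : IsAP A r := ⟨a, by rw [hcA]; exact hA⟩
  have hBP : IsAP B r := ⟨b, by rw [hcB]; exact hB⟩
  have hABP : IsAP (A + B) r := ⟨a + b, by rw [hcAB]; exact hsum⟩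
  refine ⟨fun _ _ => Or.inl ⟨r, hABP⟩, fun _ _ => Or.inl ⟨r, ?_⟩, fun _ _ => Or.inl ⟨r, ?_⟩⟩
  · rw [hmax.add_eq_neg_compl]
    exact (hAP.compl_of_zmultiples_eq_top htop).neg
  · rw [hmax.rotate.add_eq_neg_compl]
    exact (hBP.compl_of_zmultiples_eq_top htop).neg

/-! ### Impure beats: the part outside `H` is periodic, or the continuation decides -/

/-- The pair property for an impure beat in normal position relative to a nontrivial proper subgroup
`H`, given the pair property of its continuation `(A, B ∩ H, C ∩ H)`. [cite: Kemperman1960, Thm 2.1]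
[cite: BoothbyDevosMontejano2013, Def 4.3] -/
private theorem trioSumAPQP_of_isImpureBeatAt {H A B C : Finset G} (hH : IsSubgroupCarrier H)
    (hHu : H ≠ univ) (h2H : 2 ≤ #H) (h : IsImpureBeatAt H A B C) (hmax : IsMaximalTrio A B C)
    (ih : TrioSumAPQP A (B ∩ H) (C ∩ H)) : TrioSumAPQP A B C := by
  set H' : AddSubgroup G := hH.toAddSubgroup with hH'def
  have hHf : ∀ g, g ∈ H ↔ g ∈ H' := fun g => hH.mem_toAddSubgroup.symm
  have hH'b : H' ≠ ⊥ := by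
    intro hbot
    have hsub : H ⊆ {0} := fun x hx => by
      have := (hHf x).1 hx
      rw [hbot, AddSubgroup.mem_bot] at this
      exact mem_singleton.2 this
    have := card_le_card hsub
    rw [card_singleton] at this
    omega
  have hperH : IsPeriodicWith H' H := isPeriodicWith_carrier hHf
  have hAH : A ⊆ H := h.1
  have hB1 : B \ H + H = B \ H := h.2.2.1
  have hperB1 : IsPeriodicWith H' (B \ H) := (isPeriodicWith_iff_add_eq hHf).2 hB1
  obtain ⟨ih1, -, ih3⟩ := ih
  refine ⟨fun h2A h2B => ?_, fun h2B h2C => ?_, fun h2C h2A => ?_⟩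
  · -- the pair `(A, B)`: `(A + B) ∖ H = B ∖ H`
    by_cases hBH : B ⊆ H
    · have hBi : B ∩ H = B := inter_eq_left.2 hBH
      rw [hBi] at ih1
      exact ih1 h2A h2B
    · have hsd : (A + B) \ H = B \ H := h.add_sdiff_eq hH (card_pos.1 (by omega))
      refine Or.inr (isQuasiPeriodic_of_isPeriodicWith_sdiff hHf hH'b ?_ ?_)
      · rw [hsd]; exact hperB1
      · rw [hsd]
        obtain ⟨b, hb, hbH⟩ := not_subset.1 hBH
        exact ⟨b, mem_sdiff.2 ⟨hb, hbH⟩⟩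
  · -- the pair `(B, C)`: `(B + C) ∖ H = −((A ∪ H)ᶜ) = −(Hᶜ)`
    refine Or.inr (isQuasiPeriodic_of_isPeriodicWith_sdiff hHf hH'b ?_ ?_)
    · rw [hmax.add_eq_neg_compl, neg_compl_sdiff_eq hH, union_eq_right.2 hAH]
      exact hperH.compl.neg
    · rw [hmax.add_eq_neg_compl, neg_compl_sdiff_eq hH, union_eq_right.2 hAH]
      obtain ⟨x, hx⟩ : (Hᶜ : Finset G).Nonempty := by
        rw [nonempty_iff_ne_empty, Ne, compl_eq_empty_iff]; exact hHu
      exact ⟨-x, by rw [mem_neg', neg_neg]; exact hx⟩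
  · -- the pair `(C, A)`: `(C + A) ∖ H = −((B ∪ H)ᶜ)`; if empty, `C ⊆ H` and the continuation decides
    have hCA : C + A = -Bᶜ := hmax.rotate.add_eq_neg_compl
    by_cases hne : ((C + A) \ H).Nonempty
    · refine Or.inr (isQuasiPeriodic_of_isPeriodicWith_sdiff hHf hH'b ?_ hne)
      rw [hCA, neg_compl_sdiff_eq hH, ← sdiff_union_self_eq_union]
      exact (hperB1.union hperH).compl.neg
    · rw [not_nonempty_iff_eq_empty, sdiff_eq_empty_iff_subset] at hne
      have hCH : C ⊆ H := by
        intro c hc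
        obtain ⟨a, ha⟩ := card_pos.1 (by omega : 0 < #A)
        have h1 : c + a ∈ H := hne (add_mem_add hc ha)
        have h2 : a ∈ H := hAH ha
        have := hH.sub_mem h1 h2
        rwa [add_sub_cancel_right] at this
      have hCi : C ∩ H = C := inter_eq_left.2 hCH
      rw [hCi] at ih3
      exact ih3 h2C h2A

end Structures

section Chords

variable {G : Type*} [AddCommGroup G] [Fintype G] [DecidableEq G]

/-! ### Impure chords: every pair sum has a nonempty periodic part outside `H` -/

/-- The pair property for an impure chord in normal position relative to a (nontrivial, proper)
subgroup `H`: `(A + B) ∖ H`, `(B + C) ∖ H = −((H ∪ A)ᶜ)` and `(C + A) ∖ H = −((H ∪ B)ᶜ)` are nonempty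
and `H`-periodic. [cite: Kemperman1960, Thm 2.1] [cite: BoothbyDevosMontejano2013, Def 4.4] -/
private theorem trioSumAPQP_of_isImpureChordAt {H A B C : Finset G} {r : G} (hH : IsSubgroupCarrier H)
    (h2H : 2 ≤ #H) (h : IsImpureChordAt H r A B C) (hmax : IsMaximalTrio A B C) :
    TrioSumAPQP A B C := by
  set H' : AddSubgroup G := hH.toAddSubgroup with hH'def
  have hHf : ∀ g, g ∈ H ↔ g ∈ H' := fun g => hH.mem_toAddSubgroup.symm
  have hH'b : H' ≠ ⊥ := by
    intro hbot
    have hsub : H ⊆ {0} := fun x hx => by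
      have := (hHf x).1 hx
      rw [hbot, AddSubgroup.mem_bot] at this
      exact mem_singleton.2 this
    have := card_le_card hsub
    rw [card_singleton] at this
    omega
  have hgen := h.1
  obtain ⟨m, hm, hHA⟩ := h.2.1
  obtain ⟨n, hn, hHB⟩ := h.2.2.1
  obtain ⟨t, ht, htH, hmin⟩ := exists_minimal_nsmul_mem hH r
  have hlt := h.add_sub_two_lt hH hHA hHB hm ht htH hmin
  have hmt : m < t := by omega
  have hnt : n < t := by omega
  have hGcard := card_univ_eq_of_minimal hH hgen ht htH hmin
  have hperR : ∀ (a : G) (k : ℕ), IsPeriodicWith H' (rseq H r a k) := fun a k =>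
    (isPeriodicWith_iff_add_eq hHf).2 (rseq_add hH r a k)
  -- `−((rseq H r 0 k)ᶜ)` is nonempty for `k < t`
  have hne : ∀ {k : ℕ}, k < t → (-(rseq H r 0 k)ᶜ : Finset G).Nonempty := by
    intro k hk
    have hc : #(rseq H r 0 k) < #(univ : Finset G) := by
      rw [card_rseq hH hmin 0 hk.le, card_univ, hGcard]
      exact Nat.mul_lt_mul_of_pos_right hk (by omega)
    obtain ⟨x, -, hx⟩ := exists_mem_notMem_of_card_lt_card hc
    exact ⟨-x, by rw [mem_neg', neg_neg, mem_compl]; exact hx⟩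
  refine ⟨fun _ _ => Or.inr ?_, fun _ _ => Or.inr ?_, fun _ _ => Or.inr ?_⟩
  · -- `(A + B) ∖ H = rseq H r r (m + n − 2)`
    have hsd := h.add_sdiff_eq hH hHA hHB hm hn hmin hlt
    refine isQuasiPeriodic_of_isPeriodicWith_sdiff hHf hH'b (by rw [hsd]; exact hperR _ _) ?_
    rw [hsd]; exact rseq_nonempty hH r r (by omega)
  · refine isQuasiPeriodic_of_isPeriodicWith_sdiff hHf hH'b ?_ ?_
    · rw [hmax.add_eq_neg_compl, neg_compl_sdiff_eq hH, union_comm, hHA]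
      exact (hperR 0 m).compl.neg
    · rw [hmax.add_eq_neg_compl, neg_compl_sdiff_eq hH, union_comm, hHA]
      exact hne hmt
  · refine isQuasiPeriodic_of_isPeriodicWith_sdiff hHf hH'b ?_ ?_
    · rw [hmax.rotate.add_eq_neg_compl, neg_compl_sdiff_eq hH, union_comm, hHB]
      exact (hperR 0 n).compl.neg
    · rw [hmax.rotate.add_eq_neg_compl, neg_compl_sdiff_eq hH, union_comm, hHB]
      exact hne hnt

end Chords

section Transport

variable {G : Type*} [AddCommGroup G] [DecidableEq G] {H' : AddSubgroup G}

/-! ### Transport from the subgroup type `↥H'` -/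

/-- `toSub` commutes with sums (for subsets of `H'`). [cite: BoothbyDevosMontejano2013, Thm 4.5] -/
theorem toSub_add {X Y : Finset G} (hX : (X : Set G) ⊆ H')
    (hY : (Y : Set G) ⊆ H') : toSub H' (X + Y) = toSub H' X + toSub H' Y := by
  ext z
  rw [mem_toSub, mem_add, mem_add]
  constructor
  · rintro ⟨x, hx, y, hy, he⟩
    refine ⟨⟨x, hX (mem_coe.2 hx)⟩, mem_toSub.2 hx, ⟨y, hY (mem_coe.2 hy)⟩, mem_toSub.2 hy,
      Subtype.ext ?_⟩
    simpa using he
  · rintro ⟨x, hx, y, hy, rfl⟩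
    exact ⟨x, mem_toSub.1 hx, y, mem_toSub.1 hy, rfl⟩

/-- The coordinates of a sum lie in `H'`. [cite: BoothbyDevosMontejano2013, Thm 4.5] -/
theorem coe_add_subset {X Y : Finset G} (hX : (X : Set G) ⊆ H') (hY : (Y : Set G) ⊆ H') :
    ((X + Y : Finset G) : Set G) ⊆ H' := by
  intro z hz
  obtain ⟨x, hx, y, hy, rfl⟩ := mem_add.1 (mem_coe.1 hz)
  exact H'.add_mem (hX (mem_coe.2 hx)) (hY (mem_coe.2 hy))

/-- Progressions in `↥H'` are progressions in `G`. [cite: Kemperman1960, §2] -/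
theorem image_val_apFinset (a d : ↥H') (k : ℕ) :
    (apFinset a d k).image Subtype.val = apFinset (a : G) (d : G) k := by
  unfold apFinset
  rw [image_image]
  refine image_congr fun i _ => ?_
  simp

/-- A progression in the subgroup type is a progression in `G`. [cite: Kemperman1960, §2] -/
theorem isAP_of_toSub {X : Finset G} (hX : (X : Set G) ⊆ H') {d : ↥H'}
    (h : IsAP (toSub H' X) d) : IsAP X (d : G) := by
  classical
  obtain ⟨a, ha⟩ := h
  have hk : #(toSub H' X) = #X := card_toSub hX
  rw [hk] at ha
  refine ⟨(a : G), ?_⟩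
  rw [← image_val_apFinset, ← ha, image_val_toSub hX]

/-- Translation inside the subgroup type, seen in `G`. [cite: Kemperman1960, §2] -/
theorem image_val_vadd (f : ↥H') (P : Finset ↥H') :
    (f +ᵥ P).image Subtype.val = (f : G) +ᵥ P.image Subtype.val := by
  ext y
  simp only [mem_image, mem_vadd_finset]
  constructor
  · rintro ⟨x, ⟨p, hp, rfl⟩, rfl⟩
    exact ⟨p, ⟨p, hp, rfl⟩, rfl⟩
  · rintro ⟨q, ⟨p, hp, rfl⟩, rfl⟩
    exact ⟨f +ᵥ p, ⟨p, hp, rfl⟩, rfl⟩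

/-- A quasi-periodic set in the subgroup type is quasi-periodic in `G` (push the quasi-period forward
along the inclusion). [cite: Kemperman1960, §2] -/
theorem isQuasiPeriodic_of_toSub {X : Finset G} (hX : (X : Set G) ⊆ H')
    (h : IsQuasiPeriodic (toSub H' X)) : IsQuasiPeriodic X := by
  obtain ⟨F, P₁, P₀, hd, hne⟩ := h
  refine ⟨F.map H'.subtype, P₁.image Subtype.val, P₀.image Subtype.val, ⟨?_, ?_, ?_, ?_, ?_⟩,
    hne.image _⟩
  · intro hbot
    rcases F.bot_or_exists_ne_zero with hF | ⟨f, hfF, hf0⟩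
    · exact hd.ne_bot hF
    · have hmem : ((f : ↥H') : G) ∈ F.map H'.subtype := AddSubgroup.mem_map.2 ⟨f, hfF, rfl⟩
      rw [hbot, AddSubgroup.mem_bot] at hmem
      exact hf0 (Subtype.ext hmem)
  · exact (disjoint_image Subtype.val_injective).2 hd.disjoint
  · rw [← image_union, hd.union_eq, image_val_toSub hX]
  · intro g hg
    obtain ⟨f, hf, rfl⟩ := AddSubgroup.mem_map.1 hg
    have := hd.periodic f hf
    rw [AddSubgroup.coe_subtype, ← image_val_vadd, this]
  · intro x hx y hy
    obtain ⟨x', hx', rfl⟩ := mem_image.1 hx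
    obtain ⟨y', hy', rfl⟩ := mem_image.1 hy
    exact AddSubgroup.mem_map.2 ⟨x' - y', hd.sub_mem x' hx' y' hy', by simp⟩

/-- «Progression or quasi-periodic» transports from `↥H'` to `G`. [cite: Kemperman1960, Thm 2.1] -/
private theorem sumAPQP_of_toSub {X : Finset G} (hX : (X : Set G) ⊆ H')
    (h : SumAPQP (toSub H' X)) : SumAPQP X := by
  rcases h with ⟨d, hd⟩ | hq
  · exact Or.inl ⟨(d : G), isAP_of_toSub hX hd⟩
  · exact Or.inr (isQuasiPeriodic_of_toSub hX hq)

/-- The pair property transports from `↥H'` to `G`. [cite: Kemperman1960, Thm 2.1] -/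
private theorem trioSumAPQP_of_toSub {X Y Z : Finset G} (hX : (X : Set G) ⊆ H')
    (hY : (Y : Set G) ⊆ H') (hZ : (Z : Set G) ⊆ H')
    (h : TrioSumAPQP (toSub H' X) (toSub H' Y) (toSub H' Z)) : TrioSumAPQP X Y Z := by
  obtain ⟨h1, h2, h3⟩ := h
  rw [card_toSub hX, card_toSub hY, card_toSub hZ] at *
  refine ⟨fun hx hy => ?_, fun hy hz => ?_, fun hz hx => ?_⟩
  · have := h1 hx hy
    rw [← toSub_add hX hY] at this
    exact sumAPQP_of_toSub (coe_add_subset hX hY) this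
  · have := h2 hy hz
    rw [← toSub_add hY hZ] at this
    exact sumAPQP_of_toSub (coe_add_subset hY hZ) this
  · have := h3 hz hx
    rw [← toSub_add hZ hX] at this
    exact sumAPQP_of_toSub (coe_add_subset hZ hX) this

end Transport

section Main

/-! ### The induction over the Boothby–DeVos–Montejano classification -/

/-- Every maximal trio of deficiency `1` with nonempty members has the pair property: by induction on
`|G|` through `kemperman_structure_step` — pure structures are relative to the trivial subgroup
(their deficiency is `|H|`), impure ones pass to the continuation in `H`. [cite: Kemperman1960, Thm 2.1]
[cite: BoothbyDevosMontejano2013, Thm 4.5] -/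
private theorem trioSumAPQP_of_isMaximalTrio :
    ∀ (n : ℕ) (G : Type u) [AddCommGroup G] [Fintype G] [DecidableEq G], Fintype.card G = n →
      ∀ (A B C : Finset G), IsMaximalTrio A B C → trioDeficiency A B C = 1 →
        A.Nonempty → B.Nonempty → C.Nonempty → TrioSumAPQP A B C := by
  intro n
  induction n using Nat.strong_induction_on with
  | _ n ihn => ?_
  intro G _ _ _ hcard A B C hmax hδ hA hB hC
  have hδpos : 0 < trioDeficiency A B C := by rw [hδ]; exact Int.one_pos
  obtain ⟨H, hH, hHu, hstr⟩ := kemperman_structure_step hmax hδpos hA hB hC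
  classical
  rcases hstr with h | h | h | h
  · -- pure beat: `δ = |H| = 1`
    obtain ⟨-, -, hδH⟩ := h.isMaximalTrio hH
    have h1 : #H = 1 := by rw [hδ] at hδH; exact_mod_cast hδH.symm
    have hH0 := carrier_eq_singleton_zero hH h1
    subst hH0
    obtain ⟨A', B', C', hAt, hsim⟩ := h
    exact hsim.trioSumAPQP (trioSumAPQP_of_isPureBeatAt hAt)
  · -- pure chord: `δ = |H| = 1`
    obtain ⟨-, -, hδH⟩ := h.isMaximalTrio hH
    have h1 : #H = 1 := by rw [hδ] at hδH; exact_mod_cast hδH.symm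
    have hH0 := carrier_eq_singleton_zero hH h1
    subst hH0
    obtain ⟨r, A', B', C', hAt, hsim⟩ := h
    exact hsim.trioSumAPQP (trioSumAPQP_of_isPureChordAt hAt)
  · -- impure beat: continuation in `H`, induction
    obtain ⟨A₀, B₀, C₀, hs, hAt, hmaxIn, hA₀, hB₀, hC₀, hδIn⟩ := h.exists_continuation hH hmax hA hB hC
    have hmax₀ : IsMaximalTrio A₀ B₀ C₀ := hs.isMaximalTrio_iff.2 hmax
    have h2H : 2 ≤ #H :=
      two_le_card_carrier hH hmax₀.isTrio (by rw [inter_eq_left.2 hAt.1]; exact hA₀) hB₀ hC₀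
    let H' := hH.toAddSubgroup
    haveI : Fintype ↥H' := Fintype.ofFinite _
    have hHH' : ∀ x, x ∈ H' ↔ x ∈ H := fun x => hH.mem_toAddSubgroup
    have hcardH : Fintype.card ↥H' = #H := by
      have hHu' : toSub H' H = univ := eq_univ_of_forall fun x => mem_toSub.2 ((hHH' x).1 x.2)
      rw [← card_univ, ← hHu', card_toSub (fun y hy => (hHH' y).2 (mem_coe.1 hy))]
    have hlt : Fintype.card ↥H' < n := by
      rw [hcardH, ← hcard, ← card_univ]
      exact card_lt_card (ssubset_of_subset_of_ne (subset_univ H) hHu)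
    have hsubs := hmaxIn
    obtain ⟨hXH, hYH, hZH, -, -⟩ := hsubs
    have cv : ∀ {W : Finset G}, W ⊆ H → (W : Set G) ⊆ H' :=
      fun hW y hy => (hHH' y).2 (hW (mem_coe.1 hy))
    have ih := ihn _ hlt (↥H') rfl _ _ _ (isMaximalTrio_toSub hHH' hmaxIn)
      (by rw [trioDeficiency_toSub hHH' hXH hYH hZH, hδIn]; exact hδ)
      (toSub_nonempty (cv hXH) hA₀) (toSub_nonempty (cv hYH) hB₀) (toSub_nonempty (cv hZH) hC₀)
    have ih' := trioSumAPQP_of_toSub (cv hXH) (cv hYH) (cv hZH) ih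
    exact hs.trioSumAPQP (trioSumAPQP_of_isImpureBeatAt hH hHu h2H hAt hmax₀ ih')
  · -- impure chord: no induction needed
    obtain ⟨r, A₀, B₀, C₀, hs, hAt, -, hA₀, hB₀, hC₀, -⟩ := h.exists_continuation hH hmax
    have hmax₀ : IsMaximalTrio A₀ B₀ C₀ := hs.isMaximalTrio_iff.2 hmax
    have h2H : 2 ≤ #H := two_le_card_carrier hH hmax₀.isTrio hA₀ hB₀ hC₀
    exact hs.trioSumAPQP (trioSumAPQP_of_isImpureChordAt hH h2H hAt hmax₀)

/-- **Kemperman 1960, Theorem 2.1.** «Let `A`, `B` be finite subsets of `G` such that (1)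
[`|A + B| ≤ |A| + |B| − 1`] holds and `|A| ≥ 2`, `|B| ≥ 2`.  Then either `A + B` is in arithmetic
progression or `A + B` is quasi-periodic.»  Here for a FINITE abelian group (`-- TODO(general form)`:
Kemperman allows any abelian `G`).  PROOF (not Kemperman's, whose Lemma 2.2 refines Kneser's
argument): if `A + B` is periodic it is quasi-periodic; otherwise `(A, B, \overline{−(A+B)})` is a maximal
trio of deficiency `1` and the Boothby–DeVos–Montejano classification (`kemperman_structure_step`,
iterated into the continuations) is walked: pure beats and chords at deficiency `1` are relative to the
trivial subgroup (`G ∖ {0}`, sums of progressions, complements of progressions in a cyclic group),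
impure chords give sums with a nonempty `H`-periodic part outside `H`, impure beats either the same
or a pair of the continuation inside `H`. [cite: Kemperman1960, Thm 2.1]
[cite: BoothbyDevosMontejano2013, Thm 4.5] -/
theorem isAP_or_isQuasiPeriodic_add_of_card_add_le {G : Type u} [AddCommGroup G] [Fintype G]
    [DecidableEq G] {A B : Finset G} (hA : 2 ≤ #A) (hB : 2 ≤ #B)
    (hcrit : #(A + B) + 1 ≤ #A + #B) : (∃ d, IsAP (A + B) d) ∨ IsQuasiPeriodic (A + B) := by
  have hAne : A.Nonempty := card_pos.1 (by omega)
  have hBne : B.Nonempty := card_pos.1 (by omega)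
  have hABne : (A + B).Nonempty := hAne.add hBne
  by_cases hper : (A + B).addStab = {0}
  · -- aperiodic: Kneser gives equality, and `(A, B, third A B)` is a maximal trio of deficiency 1
    have h0 : ({0} : Finset G) = 0 := Finset.singleton_zero
    have hkn := add_kneser A B
    rw [hper, h0, add_zero, add_zero, Finset.card_zero] at hkn
    have heq : #(A + B) + 1 = #A + #B := by omega
    have hABu : A + B ≠ univ := by
      intro hu
      have hst : (univ : Finset G).addStab = {0} := by rw [← hu]; exact hper
      have hg : ∀ g : G, g ∈ (univ : Finset G).addStab := fun g =>
        (mem_addStab univ_nonempty).2 vadd_finset_univ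
      obtain ⟨x, y, hxy⟩ := Fintype.one_lt_card_iff.1
        (by have := card_le_univ A; omega : 1 < Fintype.card G)
      have hx := hg x
      have hy := hg y
      rw [hst, mem_singleton] at hx hy
      exact hxy (by rw [hx, hy])
    have hpure : IsPurePair A B := by
      have := isPurePair_add_addStab hAne hBne
      rwa [hper, h0, add_zero, add_zero] at this
    obtain ⟨hmax, -⟩ := (purePair_critical_iff_maximalTrio hAne hBne).1 ⟨hpure, by omega, rfl⟩
    have hδ : trioDeficiency A B (third A B) = 1 := by
      rw [trioDeficiency_third]; omega
    have hC : (third A B).Nonempty := by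
      rw [← card_pos, card_third]
      have : #(A + B) < Fintype.card G := by
        rw [← card_univ]; exact card_lt_card (ssubset_of_subset_of_ne (subset_univ _) hABu)
      omega
    exact (trioSumAPQP_of_isMaximalTrio _ G rfl A B (third A B) hmax hδ hAne hBne hC).1 hA hB
  · exact Or.inr (((isPeriodic_iff_addStab_ne hABne).2 hper).isQuasiPeriodic hABne)

end Main

end Literature.Combinatorics.Additive
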